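import Literature.NumberTheory.Transcendental.LineValues
import HarnessLib

/-!
# The auxiliary function with the sharp equation count

Topic: `Literature/NumberTheory/Transcendental`. Plan item W4/S4♯ of the unit
`provefact-Literature.NumberTheory.Transcendental.H-b596640137`. `SiegelSystem.lean` indexes the
equations of the Siegel step by `(s, k, α)` — point `s ≤ S₀`, order `k < T`, content
`α : Fin dd → Fin T` — i.e. `(S₀+1)·T·T^{dd}` rows, of which only those with `|α| = k` are
non-trivial. Since the order of a word is the size of its content, the index `k` is redundant;
here we index the rows by `(s, α)` alone (`EIdx₂`, `(S₀+1)·T^{dd}` rows, the row being zero when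
`|α| ≥ T`), which is the count `≍ S₀T^{dim 𝔟}` that the parameter economics of Baker's method
require (Baker–Wüstholz §6.8: unknowns `≍ D^n` against `≍ S T^d` conditions). PROVED:
`BakerData.exists_auxiliary₂` — the auxiliary form under the feasibility condition
`(S₀+1)·T^{dd} < (D'+1)^n`, with the same house bound `houseBound`, `F_P ≢ 0` and
`VanishesAlong 𝔟 F_P (s·v) T` for `s ≤ S₀`.

## References

* A. Baker, G. Wüstholz, *Logarithmic Forms and Diophantine Geometry*, CUP 2007, §6.8 (p. 118).
-/

noncomputable section

open Complex MvPolynomial Finset NumberField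
open scoped PeriodPair

namespace Literature.NumberTheory.Transcendental

/-- The content of a word of length `k` has total size `k`. [folklore] -/
theorem PolyODE.sum_content {d k : ℕ} (ω : Fin k → Fin d) : ∑ m, PolyODE.content ω m = k := by
  unfold PolyODE.content
  rw [← Finset.card_eq_sum_card_fiberwise (f := ω) (s := Finset.univ) (t := Finset.univ)
    (fun t _ => Finset.mem_univ _)]
  simp

namespace GaGmE

namespace Std

namespace BakerData

variable {β γ δ : Type} [Fintype β] [Fintype γ] [Fintype δ] [DecidableEq γ]
variable (B : BakerData β γ δ)

/-! ### The sharp system -/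

/-- The equations: `(s, α)` with `s ≤ S₀` and a content `α : Fin dd → Fin T`. [folklore] -/
abbrev EIdx₂ (T S₀ : ℕ) : Type := Fin (S₀ + 1) × (Fin B.dd → Fin T)

/-- The order of the row `(s, α)`: `|α| = ∑_m α_m`. [folklore] -/
def rowOrder {T : ℕ} (α : Fin B.dd → Fin T) : ℕ := ∑ m, (α m : ℕ)

/-- **The sharp Siegel matrix**: the row `(s, α)` is `d_s^{E(D,|α|)} · ∑_{content α} entryVal`
when `|α| < T`, and zero otherwise. [cite: BakerWustholz2007, §6.8 (p. 118)] -/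
def sMat₂ (D' T S₀ : ℕ) : Matrix (B.EIdx₂ T S₀) (UIdx β γ δ D') (𝓞 B.K) := fun r u =>
  if B.rowOrder r.2 < T then
    ⟨(B.dAt r.1 : B.K) ^ B.expE (Fintype.card (β ⊕ (γ ⊕ δ)) * D') (B.rowOrder r.2) *
        B.rowSum (Fintype.card (β ⊕ (γ ⊕ δ)) * D') r.1 (B.rowOrder r.2) r.2 (νOf u),
      B.isIntegral_rowSum _ _ _ _ (degree_νOf_le u)⟩
  else 0

/-- Cardinality of the equations: `(S₀+1)·T^{dd}`. [folklore] -/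
theorem card_EIdx₂ (T S₀ : ℕ) : Fintype.card (B.EIdx₂ T S₀) = (S₀ + 1) * T ^ B.dd := by
  simp [EIdx₂]

/-- The entries of the sharp matrix have house `≤ houseBound` (they are entries of the matrix of
`SiegelSystem.lean`, or zero). [folklore] -/
theorem house_sMat₂_le (D' T S₀ : ℕ) (r : B.EIdx₂ T S₀) (u : UIdx β γ δ D') :
    house ((B.sMat₂ D' T S₀ r u : 𝓞 B.K) : B.K) ≤ B.houseBound D' T S₀ := by
  unfold sMat₂
  split_ifs with h
  · have := B.house_sMat_le D' T S₀ (r.1, ⟨B.rowOrder r.2, h⟩, r.2) u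
    simpa [sMat] using this
  · have h0 : house ((0 : 𝓞 B.K) : B.K) = 0 := by simp [house]
    rw [h0]
    exact zero_le_one.trans (B.one_le_houseBound D' T S₀)

variable [DecidableEq β] [DecidableEq δ]

/-- A solution of the sharp system kills the row sums of the rows of order `< T`. [folklore] -/
theorem rowSum_eq_zero_of_mulVec₂ {D' T S₀ : ℕ} {ξ : UIdx β γ δ D' → 𝓞 B.K}
    (h : (B.sMat₂ D' T S₀).mulVec ξ = 0) (r : B.EIdx₂ T S₀) (hr : B.rowOrder r.2 < T) :
    ∑ u, (ξ u : B.K) * B.rowSum (Fintype.card (β ⊕ (γ ⊕ δ)) * D') r.1 (B.rowOrder r.2) r.2 (νOf u) = 0 := by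
  have hrow := congrFun h r
  simp only [Matrix.mulVec, dotProduct, Pi.zero_apply] at hrow
  have hrow' := congrArg (algebraMap (𝓞 B.K) B.K) hrow
  rw [map_sum, map_zero] at hrow'
  simp only [map_mul] at hrow'
  have e : ∑ u, algebraMap (𝓞 B.K) B.K (B.sMat₂ D' T S₀ r u) * algebraMap (𝓞 B.K) B.K (ξ u) =
      (B.dAt r.1 : B.K) ^ B.expE (Fintype.card (β ⊕ (γ ⊕ δ)) * D') (B.rowOrder r.2) *
        ∑ u, (ξ u : B.K) * B.rowSum (Fintype.card (β ⊕ (γ ⊕ δ)) * D') r.1 (B.rowOrder r.2) r.2 (νOf u) := by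
    rw [Finset.mul_sum]
    refine Finset.sum_congr rfl fun u _ => ?_
    rw [show algebraMap (𝓞 B.K) B.K (B.sMat₂ D' T S₀ r u) = ((B.sMat₂ D' T S₀ r u : 𝓞 B.K) : B.K) from rfl,
      show algebraMap (𝓞 B.K) B.K (ξ u) = ((ξ u : 𝓞 B.K) : B.K) from rfl]
    simp only [sMat₂, if_pos hr]
    show ((B.dAt r.1 : B.K) ^ _ * B.rowSum _ _ _ _ _) * _ = _
    ring
  rw [e] at hrow'
  exact (mul_eq_zero.mp hrow').resolve_left (pow_ne_zero _ (B.dAt_ne_zero _))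

/-- **The sharp system encodes the vanishing conditions.** [cite: BakerWustholz2007, §6.8 (p. 118)] -/
theorem vanishesAlong_of_mulVec₂ {D' T S₀ : ℕ} {ξ : UIdx β γ δ D' → 𝓞 B.K}
    (h : (B.sMat₂ D' T S₀).mulVec ξ = 0) {s : ℕ} (hs : s ≤ S₀) :
    VanishesAlong (Submodule.span ℂ (Set.range B.xs))
      (thetaEval B.L B.κM (homog (Fintype.card (β ⊕ (γ ⊕ δ)) * D') (B.QOf ξ))) ((s : ℂ) • B.v) T := by
  set D := Fintype.card (β ⊕ (γ ⊕ δ)) * D' with hD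
  refine vanishesAlong_span_of_wordForms B.L B.κM (isHomogeneous_homog D _) (B.cAt s)
    (fun x => zero_mem_chartDomain_chartChoiceAt B.L _ x) B.xs T fun k hk α => ?_
  -- word forms of `P`
  have hP : ∀ ω : Fin k → Fin B.dd, wordForm B.L B.κM (B.cAt s) B.xs ((s : ℂ) • B.v) ω (homog D (B.QOf ξ)) =
      B.emb (∑ u, (ξ u : B.K) * B.entryVal s ω D (νOf u)) := fun ω => B.wordForm_homog_QOf ξ s ω
  by_cases hsum : ∑ m, (α m : ℕ) = k
  · -- the row `(s, α)` of order `k`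
    let α' : Fin B.dd → Fin T := fun m => ⟨α m, lt_of_lt_of_le (α m).isLt (Nat.succ_le_of_lt hk)⟩
    have hord : B.rowOrder α' = k := by simp [rowOrder, α', hsum]
    have hrow := B.rowSum_eq_zero_of_mulVec₂ h (⟨s, Nat.lt_succ_of_le hs⟩, α') (by rw [hord]; exact hk)
    simp only [hord] at hrow
    have hset : Finset.univ.filter (fun ω : Fin k → Fin B.dd => ∀ m, PolyODE.content ω m = α m) =
        B.wordsOf k α' := by
      ext ω; simp [wordsOf, α']
    rw [Finset.sum_congr rfl fun ω _ => hP ω, ← map_sum, hset]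
    rw [show ∑ ω ∈ B.wordsOf k α', ∑ u, (ξ u : B.K) * B.entryVal s ω D (νOf u) =
        ∑ u, (ξ u : B.K) * B.rowSum D s k α' (νOf u) from by
      rw [Finset.sum_comm]
      refine Finset.sum_congr rfl fun u _ => ?_
      rw [rowSum, Finset.mul_sum]]
    rw [hrow, map_zero]
  · -- no word of length `k` has content `α`
    refine Finset.sum_eq_zero fun ω hω => ?_
    exfalso
    apply hsum
    have hc := (Finset.mem_filter.mp hω).2
    calc ∑ m, (α m : ℕ) = ∑ m, PolyODE.content ω m := Finset.sum_congr rfl fun m _ => (hc m).symm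
      _ = k := PolyODE.sum_content ω

/-- **The auxiliary function with the sharp count.** For `T ≥ 1` and `(S₀+1)·T^{dd} < (D'+1)^n`
there is `ξ ≠ 0` in `𝓞 K^{unknowns}` within the Siegel house bound such that `P = homog (nD') (QOf ξ)`
has `F_P ≢ 0` and vanishes to order `≥ T` along `𝔟` at `s·v`, `s ≤ S₀`.
[cite: BakerWustholz2007, §6.8 (pp. 118–119)] -/
theorem exists_auxiliary₂ (D' T S₀ : ℕ) (hT : 0 < T)
    (hpq : (S₀ + 1) * T ^ B.dd < (D' + 1) ^ Fintype.card (β ⊕ (γ ⊕ δ))) :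
    ∃ ξ : UIdx β γ δ D' → 𝓞 B.K, ξ ≠ 0 ∧
      (∀ u, house ((ξ u : 𝓞 B.K) : B.K) ≤ siegelConst B.K *
        (siegelConst B.K * ((D' + 1) ^ Fintype.card (β ⊕ (γ ⊕ δ)) : ℕ) * B.houseBound D' T S₀) ^
          ((((S₀ + 1) * T ^ B.dd : ℕ) : ℝ) /
            ((((D' + 1) ^ Fintype.card (β ⊕ (γ ⊕ δ)) : ℕ) : ℝ) - ((S₀ + 1) * T ^ B.dd : ℕ)))) ∧
      (∃ w, thetaEval B.L B.κM (homog (Fintype.card (β ⊕ (γ ⊕ δ)) * D') (B.QOf ξ)) w ≠ 0) ∧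
      ∀ s ≤ S₀, VanishesAlong (Submodule.span ℂ (Set.range B.xs))
        (thetaEval B.L B.κM (homog (Fintype.card (β ⊕ (γ ⊕ δ)) * D') (B.QOf ξ))) ((s : ℂ) • B.v) T := by
  have h0p : 0 < (S₀ + 1) * T ^ B.dd := Nat.mul_pos (Nat.succ_pos _) (pow_pos hT _)
  obtain ⟨ξ, hξ, hmul, hhouse⟩ := siegel_house B.K (B.sMat₂ D' T S₀) h0p hpq (B.card_EIdx₂ T S₀) (card_UIdx D')
    (B.one_le_houseBound D' T S₀) (fun r u => B.house_sMat₂_le D' T S₀ r u)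
  refine ⟨ξ, hξ, fun u => hhouse u, ?_, fun s hs => B.vanishesAlong_of_mulVec₂ hmul hs⟩
  exact exists_thetaEval_homog_ne_zero B.κM (B.QOf_ne_zero hξ) (B.totalDegree_QOf_le ξ)

end BakerData

end Std

end GaGmE

end Literature.NumberTheory.Transcendental

end
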